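import Summits.CriticalPhenomena.PercolationContinuityZ3.Theorems.Transplant.KNCells2ChainS
import Summits.CriticalPhenomena.PercolationContinuityZ3.Theorems.Transplant.SkelPhiHabLevels
import Summits.CriticalPhenomena.PercolationContinuityZ3.Theorems.Transplant.KNLevelsChainTransfer
import HarnessLib

/-!
# D″ node, LEVEL 1 (b) (DPRIME-SCOPE p3 addendum M, rulings R1/R2 2026-08-21T05:09:29Z): the TARGET CHAIN OF A PLANAR SCHEDULE in ANY
# exploration graph `G'` carrying a PLANAR WINDOW — typed ONCE over `(𝒲 : Skelφ.PlanarWindow G') (S : ChainPlanar.Schedule)`: the root chain and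
# the face-step inner routes (`G' = winGraph G root Rπ`, `𝒲 = planarWindowWin hlip root Rπ`, `S = Band.scheduleR …`), the corridor residue
# (`G' = winGraphIn G Ω`, `𝒲 = planarWindowIn hlip Ω`, `S =` p5-g6's localisation ∘ band schedule); φ-level, schedule-generic successor of
# stmt-g7's `Skel.WinAdvData` (`SkelWinChainTA`/`TAR`)

builds on p205010 (kernel theorem, internal audit signed; external expert review pending) — nothing in this file uses p205010.
Lane `prim-bschramm`, seat `prim-bschramm-p1` (gen 9; LEVEL 1 (b) owner per R1); helper file (`--supports stmt-CriticalPhenomena-4575 --as helper`).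
* §1 **`PlanarWindow G'`** (`W : Finset (Site 2) → Finset V`, monotone, Lipschitz nesting `∂^{out}_{G'} W(Icc lo hi) ⊆ W(Icc (lo−1) (hi+1))`);
  instances `planarWindowWin (hlip) w₀ R` (plain windows in `winGraph G w₀ R`, hp-8's `winLevel_nest`) and `planarWindowIn (hlip) Ω`
  (habitat windows in `winGraphIn G Ω`, `winLevelIn_nest`); `PlanarWindow.stepD S k = W (S.region k)`, `PlanarWindow.coreT S k = W (S.core (k+1))`.
* §2 **`WinChainData V`** (the non-planar data: level depth `Rlev`, contact count `N`, level window `j₀ j₁`, source `o`, support `Sfin`, rim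
  parts `Rim`); over `(𝒲, S)`: `stepL 𝒲 S k : LData G'` (levels `W (S.level k j)`), `stepD = W (S.region k)`, true target `coreT = W (S.core (k+1))`
  (`= X^{(k+1)}_0`), `coreE = coreT ∪ Rim k`, `stepA 𝒲 S k : TStep G'`; `stepL_X(_zero)`, `coreT_subset_X_zero_succ`, `coreT_subset_coreE`,
  `coreE_sdiff_subset`, `stepA_o/_T/_D`, **`lhyp_step`**, `encl`, `coreT_subset_stepD`, `coreE_subset_stepD`, `stepD_subset_prism`,
  **`kitsAt_stepA`** (the per-level kit clause `hkits` is a hypothesis: `Skelφ.kitClause'` / `kitClauseHab'` + `SkelPhiRouteDatum`).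
* §3 **`roomS`** (the schedule's route property at every point of a level `j ≤ j₁ ≤ Rlev < R'`) and **`lt_real_of_chainS`** (the chain of
  `S.N + 1` steps transferred to a dominating event by `KNLevels.lt_real_of_chain G'`).
[cite: KozmaNitzan2024, §4 Lemma 10 (p. 17), Lemma 11 (pp. 22–23), Lemma 12 (pp. 23–25)]
-/

noncomputable section

open MeasureTheory ProbabilityTheory
open scoped ENNReal

namespace Summit.CriticalPhenomena.PercolationContinuityZ3.Theorems.Transplant

namespace Skelφ

open Literature.Probability.Percolation Literature.Probability.LatticeModels SimpleGraph
open Literature.Probability.Percolation.KozmaNitzan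
open Literature.Probability.Percolation.KozmaNitzan.Cells (oth)
open KNLevels ChainPlanar
open Skel (winGraph winGraphIn)

variable {V : Type} [DecidableEq V]

/-! ## §1 Planar windows over an exploration graph -/

/-- **A planar window over the exploration graph `G'`**: planar finite sets ↦ finite vertex sets, monotone, with the Lipschitz nesting of
boxes (the outer boundary in `G'` of the window over `Icc lo hi` lies in the window over `Icc (lo − 1) (hi + 1)`). [this work] -/
structure PlanarWindow (G' : SimpleGraph V) [G'.LocallyFinite] where
  /-- the window over a planar set -/
  W : Finset (Site 2) → Finset V
  /-- windows grow with the planar set -/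
  mono : ∀ {P P' : Finset (Site 2)}, P ⊆ P' → W P ⊆ W P'
  /-- the Lipschitz nesting of box windows -/
  nest : ∀ lo hi : Site 2, outerBoundary G' (W (Finset.Icc lo hi)) ⊆ W (Finset.Icc (lo - 1) (hi + 1))

section Instances

variable {G : SimpleGraph V} [G.LocallyFinite] {φ : V → Site 2}

/-- **The plain windows `Skelφ.Win G φ w₀ · R`** form a planar window over `winGraph G w₀ R` (`Lip`). [folklore] -/
def planarWindowWin (hlip : Lip G φ) (w₀ : V) (R : ℕ) : PlanarWindow (winGraph G w₀ R) where
  W P := Win G φ w₀ P R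
  mono hP := Win_mono G φ hP le_rfl
  nest lo hi := by
    have h := winLevel_nest hlip w₀ R lo hi 0
    simp only [winLevel, Nat.cast_zero, sub_zero, add_zero, zero_add, Nat.cast_one] at h
    exact h

/-- The plain planar window, unfolded. [folklore] -/
@[simp] theorem planarWindowWin_W (hlip : Lip G φ) (w₀ : V) (R : ℕ) (P : Finset (Site 2)) :
    (planarWindowWin hlip w₀ R).W P = Win G φ w₀ P R := rfl

/-- **The habitat windows `Skelφ.WinIn φ Ω ·`** form a planar window over `winGraphIn G Ω` (`Lip`). [folklore] -/
def planarWindowIn (hlip : Lip G φ) (Ω : Finset V) : PlanarWindow (winGraphIn G Ω) where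
  W P := WinIn φ Ω P
  mono hP := WinIn_mono φ subset_rfl hP
  nest lo hi := by
    have h := winLevelIn_nest hlip Ω lo hi 0
    simp only [winLevelIn, Nat.cast_zero, sub_zero, add_zero, zero_add, Nat.cast_one] at h
    exact h

/-- The habitat planar window, unfolded. [folklore] -/
@[simp] theorem planarWindowIn_W (hlip : Lip G φ) (Ω : Finset V) (P : Finset (Site 2)) :
    (planarWindowIn hlip Ω).W P = WinIn φ Ω P := rfl

end Instances

/-! ## §2 The chain of a planar schedule as target steps -/

namespace PlanarWindow

variable {G' : SimpleGraph V} [G'.LocallyFinite] (𝒲 : PlanarWindow G') (S : Schedule)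

/-- **The region of step `k`**: the window over `S.region k`. [cite: KozmaNitzan2024, §4 Lemma 11 (p. 22: the slabs of Ω)] -/
def stepD (k : ℕ) : Finset V := 𝒲.W (S.region k)

/-- **The true target of step `k`**: the window over the NEXT core, `= X^{(k+1)}_0`. [cite: KozmaNitzan2024, §4 Lemma 12] -/
def coreT (k : ℕ) : Finset V := 𝒲.W (S.core (k + 1))

/-- **`T'_k ⊆ D_k`** (`k ≤ N`). [folklore] -/
theorem coreT_subset_stepD {k : ℕ} (hk : k ≤ S.N) : 𝒲.coreT S k ⊆ 𝒲.stepD S k := 𝒲.mono (S.core_succ_subset_region hk)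

/-- **`D_k` lies in the prism window** `W S.prism`. [cite: KozmaNitzan2024, §4 Lemma 11 (p. 22: Ω)] -/
theorem stepD_subset_prism {k : ℕ} (hk : k ≤ S.N) : 𝒲.stepD S k ⊆ 𝒲.W S.prism := 𝒲.mono (S.sub_prism k hk)

end PlanarWindow

/-- **The non-planar data of a window chain**: level depth, contact count, level window, source, support, rim parts of the enlarged targets.
[cite: KozmaNitzan2024, §4 Lemma 10 (p. 17), Lemma 12 (pp. 23–25)] -/
structure WinChainData (V : Type) where
  /-- the level depth of every step -/
  Rlev : ℕ
  /-- the number of contacts demanded by Step II -/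
  N : ℕ
  /-- the level window -/
  j₀ : ℕ
  /-- the level window -/
  j₁ : ℕ
  /-- the source -/
  o : V
  /-- the finite support of the weighting -/
  Sfin : Finset V
  /-- the rim part of the enlarged target of step `k` -/
  Rim : ℕ → Finset V

namespace WinChainData

variable {G' : SimpleGraph V} [G'.LocallyFinite] (P : WinChainData V) (𝒲 : PlanarWindow G') (S : Schedule)

/-- **The levels of step `k`**: `X_j = W (S.level k j)`, source `o`, support `Sfin`. [cite: KozmaNitzan2024, §4 p. 15 (B⟨j⟩), Lemma 10] -/
def stepL (k : ℕ) : LData G' := ⟨fun j => 𝒲.W (S.level k j), P.o, P.Sfin⟩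

/-- **The enlarged target of step `k`**: true target ∪ rim part. [cite: KozmaNitzan2024, §4 p. 20 (Step IV)] -/
def coreE (k : ℕ) : Finset V := 𝒲.coreT S k ∪ P.Rim k

/-- **Step `k` of the chain as a target step** in `G'`. [cite: KozmaNitzan2024, §4 Lemma 12] -/
def stepA (k : ℕ) : TStep G' := ⟨P.stepL 𝒲 S k, 𝒲.stepD S k, P.coreE 𝒲 S k, P.Rlev, P.N, P.j₀, P.j₁⟩

/-! ### The levels, the link, the containments -/

/-- The levels of step `k`, unfolded. [folklore] -/
theorem stepL_X (k j : ℕ) : (P.stepL 𝒲 S k).X j = 𝒲.W (S.level k j) := rfl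

/-- The first level of step `k` is `W (core k)`. [folklore] -/
theorem stepL_X_zero (k : ℕ) : (P.stepL 𝒲 S k).X 0 = 𝒲.W (S.core k) := by
  rw [stepL_X, S.level_zero]

/-- **The true targets link the chain**: `T'_k ⊆ X^{(k+1)}_0` (indeed equal). [cite: KozmaNitzan2024, §4 Lemma 12] -/
theorem coreT_subset_X_zero_succ (k : ℕ) : 𝒲.coreT S k ⊆ (P.stepA 𝒲 S (k + 1)).L.X 0 := by
  show 𝒲.coreT S k ⊆ (P.stepL 𝒲 S (k + 1)).X 0
  rw [P.stepL_X_zero 𝒲 S]; exact subset_rfl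

/-- The true target lies in the enlarged target. [folklore] -/
theorem coreT_subset_coreE (k : ℕ) : 𝒲.coreT S k ⊆ (P.stepA 𝒲 S k).T := Finset.subset_union_left

/-- The excess part of the enlarged target is inside the rim part. [folklore] -/
theorem coreE_sdiff_subset (k : ℕ) : (P.stepA 𝒲 S k).T \ 𝒲.coreT S k ⊆ P.Rim k := by
  intro v hv
  rw [Finset.mem_sdiff] at hv
  rcases Finset.mem_union.1 hv.1 with h | h
  · exact absurd h hv.2
  · exact h

/-- The sources agree. [folklore] -/
theorem stepA_o (k : ℕ) : (P.stepA 𝒲 S k).L.o = P.o := rfl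

/-- The targets. [folklore] -/
theorem stepA_T (k : ℕ) : (P.stepA 𝒲 S k).T = P.coreE 𝒲 S k := rfl

/-- The regions. [folklore] -/
theorem stepA_D (k : ℕ) : (P.stepA 𝒲 S k).D = 𝒲.stepD S k := rfl

/-- **The hypotheses of Lemma 10 for the levels of step `k`** from the planar window's monotonicity and nesting: a subbox `D ⊇ X_{Rl+1}` of a
finitely supported weighting and a source `o ∈ Sfin ∖ D` give `KNLevels.LHyp`. [cite: KozmaNitzan2024, §4 Lemma 10 (p. 17)] -/
theorem lhyp_step (k : ℕ) {Wt : Sym2 V → unitInterval} {p : unitInterval} {D : Finset V} {Rl : ℕ} (hsub : IsSubbox G' Wt p D)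
    (hfin : FinSupp Wt P.Sfin) (hDS : D ⊆ P.Sfin) (hencl : (P.stepL 𝒲 S k).X (Rl + 1) ⊆ D) (ho : P.o ∉ D) (hoS : P.o ∈ P.Sfin) :
    LHyp (P.stepL 𝒲 S k) Wt p D Rl where
  mono := fun _ _ h => 𝒲.mono (S.level_mono k h)
  nest j := by
    show outerBoundary G' (𝒲.W (Finset.Icc (S.lo k - ((j : ℕ) : Site 2)) (S.hi k + ((j : ℕ) : Site 2)))) ⊆
      𝒲.W (Finset.Icc (S.lo k - ((j + 1 : ℕ) : Site 2)) (S.hi k + ((j + 1 : ℕ) : Site 2)))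
    have h := 𝒲.nest (S.lo k - ((j : ℕ) : Site 2)) (S.hi k + ((j : ℕ) : Site 2))
    have e1 : S.lo k - ((j : ℕ) : Site 2) - 1 = S.lo k - ((j + 1 : ℕ) : Site 2) := by push_cast; abel
    have e2 : S.hi k + ((j : ℕ) : Site 2) + 1 = S.hi k + ((j + 1 : ℕ) : Site 2) := by push_cast; abel
    rw [e1, e2] at h
    exact h
  sub := hsub
  fin := hfin
  DS := hDS
  encl := hencl
  o_not := ho
  o_mem := hoS

/-- **`X^{(k)}_{Rlev+1} ⊆ D_k`** when `Rlev + 1 ≤ R'` (`k ≤ N`). [cite: KozmaNitzan2024, §4 Lemma 10 (p. 17: B⟨R+1⟩ ⊆ D)] -/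
theorem encl (hRl : P.Rlev + 1 ≤ S.R') {k : ℕ} (hk : k ≤ S.N) : (P.stepL 𝒲 S k).X (P.Rlev + 1) ⊆ 𝒲.stepD S k :=
  𝒲.mono (S.level_subset_region hk hRl)

/-- **`T_k ⊆ D_k`** when the rim part lies in the region. [folklore] -/
theorem coreE_subset_stepD (hRim : ∀ k, P.Rim k ⊆ 𝒲.stepD S k) {k : ℕ} (hk : k ≤ S.N) : P.coreE 𝒲 S k ⊆ 𝒲.stepD S k :=
  Finset.union_subset (𝒲.coreT_subset_stepD S hk) (hRim k)

/-! ### The kits -/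

/-- **`KitsAt` of the enlarged step `k`** (`k ≤ N`) from a subbox region in `G'`, finite support, the source off the region, a nonempty true
target, the count inequality and the per-level kit clause towards the enlarged target (for `G' = winGraph …` / `winGraphIn …` the clause is
`Skelφ.kitClause'` / `kitClauseHab'`, its `hcon'` from `SkelPhiRouteDatum` + `roomS`). [cite: KozmaNitzan2024, §4 Lemma 10 (p. 17)] -/
theorem kitsAt_stepA (hRl : P.Rlev + 1 ≤ S.R') (hRim : ∀ k, P.Rim k ⊆ 𝒲.stepD S k) {k : ℕ} (hk : k ≤ S.N)
    (hTne : (𝒲.coreT S k).Nonempty) {Wt : Sym2 V → unitInterval} {p : unitInterval} {Δ : ℕ} {δ : ℝ}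
    (hsub : IsSubbox G' Wt p (𝒲.stepD S k)) (hfin : FinSupp Wt P.Sfin) (hDS : 𝒲.stepD S k ⊆ P.Sfin)
    (ho : P.o ∉ 𝒲.stepD S k) (hoS : P.o ∈ P.Sfin) (hj : P.j₁ ≤ P.Rlev)
    (hcount : 1 / (1 - (p : ℝ)) ^ (Δ * P.N) ≤ δ * ((Finset.Icc P.j₀ P.j₁).card : ℝ))
    (hkits : ∀ j ∈ Finset.Icc P.j₀ P.j₁, ∃ (σ : SData V) (Sz : Finset V),
      SHyp (P.stepL 𝒲 S k) j σ ∧ σ.N ≤ P.N ∧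
      (1 - (p : ℝ) ^ σ.sB) ^ σ.k ≤ δ ∧ Sz ⊆ (P.stepL 𝒲 S k).X j ∧ Sz ⊆ 𝒲.stepD S k ∧
      (∀ x ∈ σ.K, ∀ e ∈ σ.seed x, e ∉ wireSet (↑Sz : Set V)) ∧ (∀ x ∈ σ.K, σ.face x ⊆ Sz) ∧
      (∀ x ∈ σ.K, 1 - 3 * δ ≤ (prodBernoulli Wt).real {ω | ∃ u ∈ σ.face x,
        1 - δ < (prodBernoulli (pinW Wt (wireSet (↑Sz : Set V)) ω)).real
          (⋃ t ∈ P.coreE 𝒲 S k, openConnIn (↑(𝒲.stepD S k) : Set V) u t)})) :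
    (P.stepA 𝒲 S k).KitsAt Wt p Δ δ :=
  ⟨P.lhyp_step 𝒲 S k hsub hfin hDS (P.encl 𝒲 S hRl hk) ho hoS, hj, P.coreE_subset_stepD 𝒲 S hRim hk,
    hTne.mono (P.coreT_subset_coreE 𝒲 S k), hcount, hkits⟩

/-! ## §3 The room and the transfer -/

omit [DecidableEq V] [G'.LocallyFinite] in
/-- **THE PLANAR ROOM OF THE CHAIN**: for `k ≤ N`, every level `j ≤ j₁` (`j₁ ≤ Rlev`, `Rlev + 1 ≤ R'`) and every planar point `v` of the level
box `S.level k j`, the schedule's route property at `v` (extent `ℓ ∈ [ℓ₀, ℓ₁]`, sign `σ`, band rectangle in `S.region k`, a half of its `σ`-side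
in `S.core (k+1)`) — the `hroom` of `Skelφ.routeDatum`. [cite: KozmaNitzan2024, §4 Lemma 11 (pp. 22–23)] -/
theorem roomS (hRl : P.Rlev + 1 ≤ S.R') (hj : P.j₁ ≤ P.Rlev) {k : ℕ} (hk : k ≤ S.N) :
    ∀ j, j ≤ P.j₁ → ∀ v ∈ S.level k j, ∃ ℓ : ℕ, S.ℓ₀ ≤ ℓ ∧ ℓ ≤ S.ℓ₁ ∧ ∃ σ : ℤ, (σ = 1 ∨ σ = -1) ∧
      (∀ y : Site 2, |y (S.ax k) - v (S.ax k)| ≤ ℓ → |y (oth (S.ax k)) - v (oth (S.ax k))| ≤ S.Wb k ℓ → y ∈ S.region k) ∧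
      ∃ τ : ℤ, (τ = 1 ∨ τ = -1) ∧ ∀ y : Site 2, y (S.ax k) - v (S.ax k) = σ * ℓ → 0 ≤ τ * (y (oth (S.ax k)) - v (oth (S.ax k))) →
        |y (oth (S.ax k)) - v (oth (S.ax k))| ≤ S.Wb k ℓ → y ∈ S.core (k + 1) :=
  fun _ hjj _ hv => S.route_level hk ((hjj.trans hj).trans (by omega)) hv

/-- **THE CHAIN TRANSFERRED**: the chain of `S.N + 1` steps in the exploration graph `G'` under a weighting `W'` with per-step facts, nonempty
true targets, rim excess `≤ η ≤ δ/2`, a chain property of length `S.N + 1` at `(δ ↦ ε'')`, a source bound towards `B₀ ⊆ X^{(0)}_0`, the last core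
inside `Ft` and `P_{W'}(⋃ t ∈ Ft, o ↔ t) ≤ μA` give `1 − ε'' < μA` (the root chain, the elongated deep routes of the face-step contacts, the corridor
chains). [cite: KozmaNitzan2024, §4 Lemma 11 (pp. 22–23), Lemma 12 (pp. 23–25), p. 20 (Step IV)] -/
theorem lt_real_of_chainS (hRl : P.Rlev + 1 ≤ S.R') (hRim : ∀ k, P.Rim k ⊆ 𝒲.stepD S k)
    (hTne : ∀ k ≤ S.N, (𝒲.coreT S k).Nonempty)
    {p : unitInterval} {W' : Sym2 V → unitInterval} {Ft B₀ : Finset V} {μA : ℝ} {Δ' : ℕ} {δ ε'' η : ℝ}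
    (hchain : ∀ (Wg : Sym2 V → unitInterval) (s : Fin (S.N + 1) → TStep G')
      (T' : Fin (S.N + 1) → Finset V) (η : ℝ),
      (∀ i, (s i).L.o = (s 0).L.o) →
      (∀ i : Fin S.N, T' (Fin.castSucc i) ⊆ (s i.succ).L.X 0) →
      (∀ i, T' i ⊆ (s i).T) →
      (∀ i, (s i).KitsAt Wg p Δ' δ) →
      η ≤ δ / 2 →
      (∀ i, (prodBernoulli Wg).real (⋃ t ∈ (s i).T \ T' i, openConn (s 0).L.o t) ≤ η) →
      1 - δ < (prodBernoulli Wg).real (s 0).L.reachB →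
        1 - ε'' < (prodBernoulli Wg).real (⋃ t ∈ T' (Fin.last S.N), openConn (s 0).L.o t))
    (hsub : ∀ k ≤ S.N, IsSubbox G' W' p (𝒲.stepD S k)) (hfin : FinSupp W' P.Sfin)
    (hDS : ∀ k ≤ S.N, 𝒲.stepD S k ⊆ P.Sfin) (ho : ∀ k ≤ S.N, P.o ∉ 𝒲.stepD S k) (hoS : P.o ∈ P.Sfin) (hj : P.j₁ ≤ P.Rlev)
    (hcount : 1 / (1 - (p : ℝ)) ^ (Δ' * P.N) ≤ δ * ((Finset.Icc P.j₀ P.j₁).card : ℝ))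
    (hkits : ∀ k ≤ S.N, ∀ j ∈ Finset.Icc P.j₀ P.j₁, ∃ (σ : SData V) (Sz : Finset V),
      SHyp (P.stepL 𝒲 S k) j σ ∧ σ.N ≤ P.N ∧
      (1 - (p : ℝ) ^ σ.sB) ^ σ.k ≤ δ ∧ Sz ⊆ (P.stepL 𝒲 S k).X j ∧ Sz ⊆ 𝒲.stepD S k ∧
      (∀ x ∈ σ.K, ∀ e ∈ σ.seed x, e ∉ wireSet (↑Sz : Set V)) ∧ (∀ x ∈ σ.K, σ.face x ⊆ Sz) ∧
      (∀ x ∈ σ.K, 1 - 3 * δ ≤ (prodBernoulli W').real {ω | ∃ u ∈ σ.face x,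
        1 - δ < (prodBernoulli (pinW W' (wireSet (↑Sz : Set V)) ω)).real
          (⋃ t ∈ P.coreE 𝒲 S k, openConnIn (↑(𝒲.stepD S k) : Set V) u t)}))
    (hη : η ≤ δ / 2) (hexc : ∀ k ≤ S.N, (prodBernoulli W').real (⋃ t ∈ P.Rim k, openConn P.o t) ≤ η)
    (hB₀ : B₀ ⊆ (P.stepL 𝒲 S 0).X 0) (hsrc : 1 - δ < (prodBernoulli W').real (⋃ t ∈ B₀, openConn P.o t))
    (hTn : 𝒲.coreT S S.N ⊆ Ft) (hdom : (prodBernoulli W').real (⋃ t ∈ Ft, openConn P.o t) ≤ μA) :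
    1 - ε'' < μA := by
  let s : Fin (S.N + 1) → TStep G' := fun i => P.stepA 𝒲 S i
  let T' : Fin (S.N + 1) → Finset V := fun i => 𝒲.coreT S i
  have hle : ∀ i : Fin (S.N + 1), (i : ℕ) ≤ S.N := fun i => Nat.lt_succ_iff.1 i.2
  refine lt_real_of_chain G' hchain s T' (fun i => P.stepA_o 𝒲 S i) (fun i => ?_) (fun i => P.coreT_subset_coreE 𝒲 S i)
    (fun i => ?_) hη (fun i => ?_) ?_ ?_ hdom
  · -- the true targets link the chain
    show 𝒲.coreT S (Fin.castSucc i) ⊆ (P.stepA 𝒲 S i.succ).L.X 0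
    have : ((i.succ : Fin (S.N + 1)) : ℕ) = (Fin.castSucc i : ℕ) + 1 := by simp
    rw [show P.stepA 𝒲 S (i.succ : ℕ) = P.stepA 𝒲 S ((Fin.castSucc i : ℕ) + 1) by rw [this]]
    exact P.coreT_subset_X_zero_succ 𝒲 S _
  · exact P.kitsAt_stepA 𝒲 S hRl hRim (hle i) (hTne i (hle i)) (hsub i (hle i)) hfin (hDS i (hle i)) (ho i (hle i)) hoS hj hcount
      (hkits i (hle i))
  · -- the excess of the enlarged target is inside the rim part
    refine le_trans (measureReal_mono ?_ (measure_ne_top _ _)) (hexc i (hle i))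
    intro ω hω
    simp only [Set.mem_iUnion, exists_prop] at hω ⊢
    obtain ⟨t, ht, hωt⟩ := hω
    exact ⟨t, P.coreE_sdiff_subset 𝒲 S i ht, hωt⟩
  · -- the source bound: `B₀ ⊆ X^{(0)}_0`
    show 1 - δ < (prodBernoulli W').real (P.stepA 𝒲 S ((0 : Fin (S.N + 1)) : ℕ)).L.reachB
    rw [Fin.val_zero]
    refine hsrc.trans_le (measureReal_mono ?_ (measure_ne_top _ _))
    intro ω hω
    simp only [Set.mem_iUnion, exists_prop] at hω
    obtain ⟨t, ht, hωt⟩ := hω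
    show ω ∈ (P.stepL 𝒲 S 0).reachB
    exact Set.mem_biUnion (Finset.mem_coe.2 (hB₀ ht)) hωt
  · -- the last core lies in `Ft`
    show 𝒲.coreT S ((Fin.last S.N : Fin (S.N + 1)) : ℕ) ⊆ Ft
    rw [Fin.val_last]; exact hTn

end WinChainData

end Skelφ

end Summit.CriticalPhenomena.PercolationContinuityZ3.Theorems.Transplant

end
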